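import Summits.BirchSwinnertonDyer.BirchSwinnertonDyer.Theorems.BiquadraticEisensteinDescentHeegnerTwistCouplingInSupplySplitPrimeOrderBound
import Summits.BirchSwinnertonDyer.BirchSwinnertonDyer.Theorems.BiquadraticEisensteinDescentHeegnerTwistCouplingInSupplyNonNullFailsAtTwo
import Summits.BirchSwinnertonDyer.BirchSwinnertonDyer.Theorems.BiquadraticEisensteinDescentHeegnerTwistCouplingInSupplySizeIndivisibleSharp
import Literature.NumberTheory.QuadraticFields.RingClassGroup
import HarnessLib

set_option linter.dupNamespace false -- `Summit.BirchSwinnertonDyer.BirchSwinnertonDyer.Theorems.…` (summit = sub, D-0017)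
set_option autoImplicit false

/-!
# Crux `HeegnerTwistCouplingInSupply` (stmt-BirchSwinnertonDyer-21381), card `genus-doubling-free-box` —
# the families `d = x² − 4ℓⁿ` / `d = x² − 2ⁿ` (`ord[𝔩] = n`, `n ∣ h`) and the `p`-indivisibility certificates

Route `BiquadraticEisensteinDescent` (cell `pub/bsd-wall`; width seat `bsd-wall-cm-bed-w4` g25; theorems only,
`--supports 21381`). Sequel of `…SplitPrimeOrder.lean` / `…SplitPrimeOrderBound.lean`.

* §6 ★ `exists_orderOf_eq_of_discr_eq_sq_sub` / `dvd_classNumber_of_discr_eq_sq_sub` — for an imaginary quadratic `K`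
  with `d_K = x² − 4ℓⁿ` (`ℓ` prime, `ℓ ∤ x`, `n ≥ 1`) and `|d_K| > 4ℓ^{n−1}`: the element `π = (x + √d_K)/2 ∈ 𝓞_K` has norm
  `ℓⁿ` and is primitive, so ONE prime `𝔩 ∣ ℓ` has a class of order EXACTLY `n`, and `n ∣ h_K` (the Nagell / Ankeny–Chowla
  mechanism for class numbers divisible by `n`).
* §7 ★ `exists_orderOf_eq_sub_two_of_discr_eq_sq_sub_two_pow` / `sub_two_dvd_classNumber_of_discr_eq_sq_sub_two_pow` —
  the card's Mersenne family (M1): `d_K = x² − 2ⁿ`, `x` odd, `n ≥ 3`, `x² < 2^{n−1}` ⟹ `ord[𝔭₂] = n − 2` and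
  `(n − 2) ∣ h_K` (kit census j328142 of the ideation seat: 4 348 members, 0 violations — now a theorem).
* §8 certificates ★ `not_dvd_classNumber_of_dvd_of_sqrt_mul_log_lt` — `m ∣ h_K`, `p` an odd prime with `p ∤ m`, and
  `√|d_K|·log|d_K| < π·p·lcm(m, 2^{ω(|d_K|)−1})` ⟹ `p ∤ h_K` (Lagrange: `p, m, 2^{ω−1} ∣ h_K` would give
  `p·lcm ∣ h_K`, against Oesterlé–Gauss `h_K ≤ π⁻¹√|d_K| log|d_K|` — tree `Quadratic.classNumber_le_sqrt_mul_log` — and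
  genus theory `2^{ω−1} ∣ h_K` — tree `two_pow_card_primeFactors_sub_one_dvd_classNumber`); the card's lever (G)
  `not_dvd_classNumber_of_sqrt_mul_log_lt_genus` is the case `m = 1` (first proved in the ideation seat's sketch
  `SketchIdeasSeat2G26.lean` §1, re-proved here), and lever (M) `not_dvd_classNumber_mersenne` is `m = n − 2` on the
  Mersenne family: the `h`-half of the crux's coupling is TRUE BY CERTIFICATE on that structured box, uniformly in `p`.

HONEST FRAMING: `h`-side certificates of a RELIEF lever only; no `L(W^d, 1)`, no C⁺, crux 21381 and BSD NOT proved.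
No definition, no named fact, no `sorry`; axioms standard.
[cite: Oesterle1985, §1.4 a) (p. 312)] [cite: Oesterle1988Gauss, II §3 Proposition p. 57 (27)]
[cite: Cox2013, §3.B Thm. 3.15, §7.B Thm. 7.7]
-/

noncomputable section

open scoped Classical NumberTheorySymbols nonZeroDivisors
open Module NumberField Ideal IsDedekindDomain
open Literature.NumberTheory.QuadraticFields Literature.NumberTheory.QuadraticFields.Quadratic
open Literature.NumberTheory.EllipticCurves
open Summit.BirchSwinnertonDyer.BirchSwinnertonDyer.Theorems.BiquadraticEisensteinDescentHeegnerTwistCouplingInSupplyNonNullFailsAtTwo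
open Summit.BirchSwinnertonDyer.BirchSwinnertonDyer.Theorems.BiquadraticEisensteinDescentHeegnerTwistCouplingInSupplySizeIndivisibleSharp

namespace Summit.BirchSwinnertonDyer.BirchSwinnertonDyer.Theorems.SplitPrimeOrder

variable {K : Type*} [Field K] [NumberField K]

/-! ## §6 The family `d_K = x² − 4ℓⁿ`: `ord[𝔩] = n`, `n ∣ h_K` -/

/-- **The element `π = (x + √d_K)/2` of the family `d_K = x² − 4ℓⁿ`.** For a quadratic field `K` with integral basis
`(1, ω)`, `ω² = m + tω`, `d_K = t² + 4m = x² − 4ℓⁿ`: `x ≡ t (mod 2)` and `π := (x − t)/2 + ω` has `N(π) = ℓⁿ` and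
`ω`-coordinate `1` (so `π ∉ ℓ𝓞_K`). [cite: Cox2013, §7.B Thm. 7.7] -/
theorem exists_norm_eq_pow_of_discr_eq_sq_sub (h2 : finrank ℚ K = 2) {ℓ : ℕ} (hℓ : ℓ.Prime)
    {x : ℤ} {n : ℕ} (hd : NumberField.discr K = x ^ 2 - 4 * (ℓ : ℤ) ^ n) :
    ∃ π : 𝓞 K, (Algebra.norm ℤ π).natAbs = ℓ ^ n ∧ π ∉ span {(ℓ : 𝓞 K)} := by
  obtain ⟨b, hb⟩ := exists_basis_zero_eq_one h2
  set m : ℤ := b.repr (b 1 * b 1) 0 with hm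
  set t : ℤ := b.repr (b 1 * b 1) 1 with ht
  have hω : b 1 * b 1 = (m : 𝓞 K) + (t : 𝓞 K) * b 1 := basis_one_mul_self_eq b hb
  have hD : NumberField.discr K = t ^ 2 + 4 * m := discr_eq_sq_add_four_mul b hb
  -- `x ≡ t (mod 2)`
  have h2dvd : (2 : ℤ) ∣ (x - t) * (x + t) :=
    ⟨2 * ((ℓ : ℤ) ^ n + m), by linear_combination hd.symm.trans hD⟩
  have hxt : (2 : ℤ) ∣ x - t := by
    rcases Int.prime_two.dvd_or_dvd h2dvd with h | h
    · exact h
    · omega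
  obtain ⟨a, ha⟩ := hxt
  refine ⟨(a : 𝓞 K) + ((1 : ℤ) : 𝓞 K) * b 1, ?_, ?_⟩
  · have hN := norm_intCast_add_intCast_mul b hb hω a 1
    have hval : a ^ 2 + t * a * 1 - m * 1 ^ 2 = (ℓ : ℤ) ^ n := by
      have hx : x = 2 * a + t := by omega
      have key : t ^ 2 + 4 * m = (2 * a + t) ^ 2 - 4 * (ℓ : ℤ) ^ n := by
        rw [← hx]; exact hD.symm.trans hd
      have h4 : (4 : ℤ) * (a ^ 2 + t * a * 1 - m * 1 ^ 2) = 4 * (ℓ : ℤ) ^ n := by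
        linear_combination (-1 : ℤ) * key
      exact mul_left_cancel₀ (by norm_num : (4 : ℤ) ≠ 0) h4
    rw [hN, hval, Int.natAbs_pow, Int.natAbs_natCast]
  · intro hmem
    have h1 := RingClass.dvd_repr_of_mem_span b hmem 1
    rw [repr_intCast_add_intCast_mul_one b hb] at h1
    have : (ℓ : ℤ) ≤ 1 := Int.le_of_dvd one_pos h1
    have := hℓ.two_le
    omega

/-- **Split data for the family**: `d_K = x² − 4ℓⁿ` with `ℓ ∤ x` and `n ≥ 1` forces `ℓ` to split in `K` — for odd `ℓ`,
`(d_K/ℓ) = (x²/ℓ) = 1`; for `ℓ = 2`, `x` odd gives `d_K ≡ x² ≡ 1 (mod 8)`. [cite: Cox2013, §5.B Prop. 5.16] -/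
theorem splitData_of_discr_eq_sq_sub (h2 : finrank ℚ K = 2) {ℓ : ℕ} (hℓ : ℓ.Prime)
    {x : ℤ} {n : ℕ} (hn : 1 ≤ n) (hd : NumberField.discr K = x ^ 2 - 4 * (ℓ : ℤ) ^ n)
    (hx : ¬ (ℓ : ℤ) ∣ x) :
    ((span {(ℓ : ℤ)}).primesOver (𝓞 K)).ncard = 2 ∧
      ∀ P ∈ (span {(ℓ : ℤ)}).primesOver (𝓞 K), absNorm P = ℓ := by
  by_cases hℓ2 : ℓ = 2
  · subst hℓ2
    refine splitData_two h2 ?_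
    -- `x` odd, `8 ∣ 4·2ⁿ`
    have hxodd : Odd x := by
      rcases Int.even_or_odd x with ⟨k, hk⟩ | hodd
      · exact absurd ⟨k, by rw [hk]; ring⟩ hx
      · exact hodd
    obtain ⟨k, hk⟩ := hxodd
    obtain ⟨i, hi⟩ := Int.even_mul_succ_self k
    have hx2 : x ^ 2 = 8 * i + 1 := by rw [hk]; linear_combination 4 * hi
    have hpow : (4 : ℤ) * (2 : ℤ) ^ n = 8 * 2 ^ (n - 1) := by
      obtain ⟨r, rfl⟩ := Nat.exists_eq_add_of_le hn
      rw [Nat.add_sub_cancel_left, pow_add, pow_one]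
      ring
    have : NumberField.discr K = 8 * (i - 2 ^ (n - 1)) + 1 := by
      push_cast at hd
      rw [hd, hx2, hpow]; ring
    omega
  · refine splitData_of_jacobiSym h2 hℓ hℓ2 ?_
    have hmod : NumberField.discr K % (ℓ : ℤ) = x ^ 2 % (ℓ : ℤ) := by
      have hme : x ^ 2 - 4 * (ℓ : ℤ) ^ n ≡ x ^ 2 [ZMOD (ℓ : ℤ)] := by
        rw [Int.modEq_iff_dvd]
        refine ⟨4 * (ℓ : ℤ) ^ (n - 1), ?_⟩
        obtain ⟨r, rfl⟩ := Nat.exists_eq_add_of_le hn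
        rw [Nat.add_sub_cancel_left, pow_add, pow_one]
        ring
      rw [hd]
      exact hme
    rw [jacobiSym.mod_left' hmod]
    refine jacobiSym.sq_one' ?_
    have hcop : Nat.Coprime ℓ x.natAbs :=
      (Nat.Prime.coprime_iff_not_dvd hℓ).mpr (fun h => hx (Int.natCast_dvd.mpr h))
    rw [Int.gcd, Int.natAbs_natCast]
    exact hcop.symm

/-- ★ **`ord[𝔩] = n` in the family `d_K = x² − 4ℓⁿ`.** For an imaginary quadratic field `K` with `d_K = x² − 4ℓⁿ`
(`ℓ` prime, `ℓ ∤ x`, `n ≥ 1`) and `|d_K| > 4·ℓ^{n−1}`: the class of one prime `𝔩 ∣ ℓ` of `𝓞_K` has order exactly `n`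
(`(π) = 𝔩ⁿ` for `π = (x + √d_K)/2`, and `ℓ^{ord[𝔩]} ≥ |d_K|/4 > ℓ^{n−1}`).
[cite: Oesterle1985, §1.4 a) (p. 312)] [cite: Cox2013, §7.B Thm. 7.7] -/
theorem exists_orderOf_eq_of_discr_eq_sq_sub (hK : IsImaginaryQuadratic K) {ℓ : ℕ} (hℓ : ℓ.Prime)
    {x : ℤ} {n : ℕ} (hn : 1 ≤ n) (hd : NumberField.discr K = x ^ 2 - 4 * (ℓ : ℤ) ^ n)
    (hx : ¬ (ℓ : ℤ) ∣ x) (hbig : 4 * ℓ ^ (n - 1) < (NumberField.discr K).natAbs) :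
    ∃ P ∈ (span {(ℓ : ℤ)}).primesOver (𝓞 K), ∃ hP0 : P ∈ (Ideal (𝓞 K))⁰,
      orderOf (ClassGroup.mk0 ⟨P, hP0⟩) = n := by
  obtain ⟨hcount, hnorm⟩ := splitData_of_discr_eq_sq_sub hK.1 hℓ hn hd hx
  obtain ⟨π, hNπ, hπℓ⟩ := exists_norm_eq_pow_of_discr_eq_sq_sub hK.1 hℓ hd
  obtain ⟨P, hP, hP0, -, hord⟩ :=
    exists_orderOf_eq_of_norm_eq_pow hK.1 hK.discr_neg hℓ hcount hnorm hn hNπ hπℓ hbig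
  exact ⟨P, hP, hP0, hord⟩

/-- ★ **`n ∣ h_K` in the family `d_K = x² − 4ℓⁿ`** (`K` imaginary quadratic, `ℓ` prime, `ℓ ∤ x`, `n ≥ 1`,
`|d_K| > 4·ℓ^{n−1}`). [cite: Oesterle1985, §1.4 a) (p. 312)] [cite: Cox2013, §7.B Thm. 7.7] -/
theorem dvd_classNumber_of_discr_eq_sq_sub (hK : IsImaginaryQuadratic K) {ℓ : ℕ} (hℓ : ℓ.Prime)
    {x : ℤ} {n : ℕ} (hn : 1 ≤ n) (hd : NumberField.discr K = x ^ 2 - 4 * (ℓ : ℤ) ^ n)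
    (hx : ¬ (ℓ : ℤ) ∣ x) (hbig : 4 * ℓ ^ (n - 1) < (NumberField.discr K).natAbs) :
    n ∣ NumberField.classNumber K := by
  obtain ⟨P, -, hP0, hord⟩ := exists_orderOf_eq_of_discr_eq_sq_sub hK hℓ hn hd hx hbig
  rw [← hord, NumberField.classNumber]
  exact orderOf_dvd_card

/-! ## §7 The card's Mersenne family `d_K = x² − 2ⁿ`: `ord[𝔭₂] = n − 2`, `(n − 2) ∣ h_K` -/

/-- Size bookkeeping for `d = x² − 2ⁿ < 0` with `x² < 2^{n−1}`, `n ≥ 3`: `|d| > 4·2^{(n−2)−1}`. [folklore] -/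
theorem four_mul_two_pow_lt_natAbs {d x : ℤ} {n : ℕ} (hn : 3 ≤ n) (hd : d = x ^ 2 - 2 ^ n)
    (hsmall : x ^ 2 < 2 ^ (n - 1)) : 4 * 2 ^ (n - 2 - 1) < d.natAbs := by
  obtain ⟨r, rfl⟩ := Nat.exists_eq_add_of_le hn
  have h1 : 3 + r - 2 - 1 = r := by omega
  have h2 : 3 + r - 1 = r + 2 := by omega
  rw [h1]
  rw [h2] at hsmall
  have hpow : (2 : ℤ) ^ (3 + r) = 8 * 2 ^ r := by rw [pow_add]; ring
  have hpow' : (2 : ℤ) ^ (r + 2) = 4 * 2 ^ r := by rw [pow_add]; ring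
  rw [hpow] at hd
  rw [hpow'] at hsmall
  have hx0 : 0 ≤ x ^ 2 := sq_nonneg x
  have hdneg : d < 0 := by omega
  have habs : (d.natAbs : ℤ) = -d := Int.ofNat_natAbs_of_nonpos hdneg.le
  have key : (4 : ℤ) * 2 ^ r < -d := by omega
  have : ((4 * 2 ^ r : ℕ) : ℤ) < (d.natAbs : ℤ) := by rw [habs]; exact_mod_cast key
  exact_mod_cast this

/-- ★ **`ord[𝔭₂] = n − 2` on the Mersenne family** (the card's «next checkable statement (M1)»): for an imaginary
quadratic field `K` with `d_K = x² − 2ⁿ`, `x` odd, `n ≥ 3` and `x² < 2^{n−1}`, the class of one prime `𝔭₂ ∣ 2` has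
order exactly `n − 2` (`𝔭₂^{n−2} = ((x + √d_K)/2)`; no smaller power is principal since `2^k ≥ |d_K|/4 > 2^{n−3}`).
[cite: Oesterle1985, §1.4 a) (p. 312)] [cite: Cox2013, §7.B Thm. 7.7] -/
theorem exists_orderOf_eq_sub_two_of_discr_eq_sq_sub_two_pow (hK : IsImaginaryQuadratic K)
    {x : ℤ} {n : ℕ} (hn : 3 ≤ n) (hd : NumberField.discr K = x ^ 2 - 2 ^ n) (hx : Odd x)
    (hsmall : x ^ 2 < 2 ^ (n - 1)) :
    ∃ P ∈ (span {((2 : ℕ) : ℤ)}).primesOver (𝓞 K), ∃ hP0 : P ∈ (Ideal (𝓞 K))⁰,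
      orderOf (ClassGroup.mk0 ⟨P, hP0⟩) = n - 2 := by
  have hd' : NumberField.discr K = x ^ 2 - 4 * ((2 : ℕ) : ℤ) ^ (n - 2) := by
    rw [hd]
    obtain ⟨r, rfl⟩ := Nat.exists_eq_add_of_le hn
    rw [show 3 + r - 2 = r + 1 by omega, pow_add]
    push_cast
    ring
  have hx2 : ¬ ((2 : ℕ) : ℤ) ∣ x := by
    obtain ⟨k, hk⟩ := hx
    push_cast
    omega
  exact exists_orderOf_eq_of_discr_eq_sq_sub hK Nat.prime_two (by omega) hd' hx2
    (four_mul_two_pow_lt_natAbs hn hd hsmall)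

/-- ★ **`(n − 2) ∣ h_K` on the Mersenne family** `d_K = x² − 2ⁿ` (`x` odd, `n ≥ 3`, `x² < 2^{n−1}`).
[cite: Oesterle1985, §1.4 a) (p. 312)] [cite: Cox2013, §7.B Thm. 7.7] -/
theorem sub_two_dvd_classNumber_of_discr_eq_sq_sub_two_pow (hK : IsImaginaryQuadratic K)
    {x : ℤ} {n : ℕ} (hn : 3 ≤ n) (hd : NumberField.discr K = x ^ 2 - 2 ^ n) (hx : Odd x)
    (hsmall : x ^ 2 < 2 ^ (n - 1)) :
    (n - 2) ∣ NumberField.classNumber K := by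
  obtain ⟨P, -, hP0, hord⟩ := exists_orderOf_eq_sub_two_of_discr_eq_sq_sub_two_pow hK hn hd hx hsmall
  rw [← hord, NumberField.classNumber]
  exact orderOf_dvd_card

/-! ## §8 `p`-indivisibility certificates from known divisors of `h_K` -/

/-- **Oesterlé–Gauss against a real bound**: for `K` imaginary quadratic with `|d_K| > 4` and any real `B` with
`√|d_K|·log|d_K| < π·B`: `h_K < B` (tree: `Quadratic.classNumber_le_sqrt_mul_log`; the `B = p` case is
`…SizeIndivisibleSharp.classNumber_lt_of_sqrt_mul_log_lt`). [cite: Oesterle1988Gauss, II §3 Proposition p. 57 (27)] -/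
theorem classNumber_lt_of_sqrt_mul_log_lt_pi_mul (hK : IsImaginaryQuadratic K)
    (h4 : 4 < (NumberField.discr K).natAbs) {B : ℝ}
    (hlt : Real.sqrt ((NumberField.discr K).natAbs : ℝ) * Real.log ((NumberField.discr K).natAbs : ℝ) <
      Real.pi * B) :
    (NumberField.classNumber K : ℝ) < B := by
  have hle := Quadratic.classNumber_le_sqrt_mul_log hK.1 (discr_lt_neg_four hK h4)
  rw [← natCast_natAbs_discr K] at hle
  have hπ := Real.pi_pos
  have hlt' : Real.pi⁻¹ * Real.sqrt ((NumberField.discr K).natAbs : ℝ) *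
      Real.log ((NumberField.discr K).natAbs : ℝ) < B := by
    rw [mul_assoc, inv_mul_lt_iff₀ hπ]
    exact hlt
  exact hle.trans_lt hlt'

/-- ★ **Certificate from a known divisor.** `K` imaginary quadratic with `|d_K| > 4`, `m ∣ h_K`, `p` an odd prime with
`p ∤ m`, and `√|d_K|·log|d_K| < π·p·lcm(m, 2^{ω(|d_K|)−1})` ⟹ `p ∤ h_K`. (If `p ∣ h_K` then `p`, `m` and the genus
factor `2^{ω−1}` all divide `h_K`, so `p·lcm(m, 2^{ω−1}) ∣ h_K`, contradicting `h_K ≤ π⁻¹√|d_K| log|d_K|`.)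
[cite: Oesterle1988Gauss, II §3 Proposition p. 57 (27)] [cite: Cox2013, §3.B Thm. 3.15] -/
theorem not_dvd_classNumber_of_dvd_of_sqrt_mul_log_lt (hK : IsImaginaryQuadratic K)
    (h4 : 4 < (NumberField.discr K).natAbs) {m p : ℕ} (hm : m ∣ NumberField.classNumber K)
    (hp : p.Prime) (hp2 : p ≠ 2) (hpm : ¬ p ∣ m)
    (hlt : Real.sqrt ((NumberField.discr K).natAbs : ℝ) * Real.log ((NumberField.discr K).natAbs : ℝ) <
      Real.pi * (p * Nat.lcm m (2 ^ ((NumberField.discr K).natAbs.primeFactors.card - 1)) : ℕ)) :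
    ¬ p ∣ NumberField.classNumber K := by
  intro hdvd
  set g := 2 ^ ((NumberField.discr K).natAbs.primeFactors.card - 1) with hg
  have hgen : g ∣ NumberField.classNumber K := two_pow_card_primeFactors_sub_one_dvd_classNumber hK
  have hlcm : Nat.lcm m g ∣ NumberField.classNumber K := Nat.lcm_dvd hm hgen
  have hcopm : Nat.Coprime p m := (Nat.Prime.coprime_iff_not_dvd hp).mpr hpm
  have hcopg : Nat.Coprime p g :=
    Nat.Coprime.pow_right _ ((Nat.coprime_primes hp Nat.prime_two).2 hp2)
  have hcop : Nat.Coprime p (Nat.lcm m g) :=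
    Nat.Coprime.coprime_dvd_right (Nat.lcm_dvd_mul m g) (Nat.Coprime.mul_right hcopm hcopg)
  have hmul : p * Nat.lcm m g ∣ NumberField.classNumber K := Nat.Coprime.mul_dvd_of_dvd_of_dvd hcop hdvd hlcm
  have hle : p * Nat.lcm m g ≤ NumberField.classNumber K := Nat.le_of_dvd Fintype.card_pos hmul
  have hltR := classNumber_lt_of_sqrt_mul_log_lt_pi_mul hK h4 hlt
  have hltN : NumberField.classNumber K < p * Nat.lcm m g := by exact_mod_cast hltR
  omega

/-- ★ **Lever (G) of the card — the genus-doubled free box** (first proved in the ideation seat's sketch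
`Cruxes/HeegnerTwistCouplingInSupply/SketchIdeasSeat2G26.lean` §1, re-proved here as the case `m = 1`): for `K` imaginary
quadratic with `|d_K| > 4`, `p` an odd prime and `√|d_K|·log|d_K| < π·p·2^{ω(|d_K|)−1}`: `p ∤ h_K`.
[cite: Oesterle1988Gauss, II §3 Proposition p. 57 (27)] [cite: Cox2013, §3.B Thm. 3.15] -/
theorem not_dvd_classNumber_of_sqrt_mul_log_lt_genus (hK : IsImaginaryQuadratic K)
    (h4 : 4 < (NumberField.discr K).natAbs) {p : ℕ} (hp : p.Prime) (hp2 : p ≠ 2)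
    (hlt : Real.sqrt ((NumberField.discr K).natAbs : ℝ) * Real.log ((NumberField.discr K).natAbs : ℝ) <
      Real.pi * (p * 2 ^ ((NumberField.discr K).natAbs.primeFactors.card - 1) : ℕ)) :
    ¬ p ∣ NumberField.classNumber K := by
  refine not_dvd_classNumber_of_dvd_of_sqrt_mul_log_lt hK h4 (one_dvd _) hp hp2 hp.not_dvd_one ?_
  rwa [Nat.lcm_one_left]

/-- ★ **Lever (M) of the card — the Mersenne certificate.** For `K` imaginary quadratic with `d_K = x² − 2ⁿ` (`x` odd,
`n ≥ 3`, `x² < 2^{n−1}`, so `|d_K| > 4`), `p` an odd prime with `p ∤ n − 2`, and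
`√|d_K|·log|d_K| < π·p·lcm(n − 2, 2^{ω(|d_K|)−1})`: `p ∤ h_K` — the logarithm of Oesterlé's bound is cancelled by the
order `n − 2 ≈ log₂|d_K|` of `[𝔭₂]`, so the certified box reaches `|d| ≍ 4^{ω−1}·p²` instead of `p²/log²p`.
[cite: Oesterle1985, §1.4 a) (p. 312)] [cite: Oesterle1988Gauss, II §3 Proposition p. 57 (27)] [cite: Cox2013, §3.B Thm. 3.15] -/
theorem not_dvd_classNumber_mersenne (hK : IsImaginaryQuadratic K)
    {x : ℤ} {n : ℕ} (hn : 3 ≤ n) (hd : NumberField.discr K = x ^ 2 - 2 ^ n) (hx : Odd x)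
    (hsmall : x ^ 2 < 2 ^ (n - 1)) {p : ℕ} (hp : p.Prime) (hp2 : p ≠ 2) (hpn : ¬ p ∣ n - 2)
    (hlt : Real.sqrt ((NumberField.discr K).natAbs : ℝ) * Real.log ((NumberField.discr K).natAbs : ℝ) <
      Real.pi * (p * Nat.lcm (n - 2) (2 ^ ((NumberField.discr K).natAbs.primeFactors.card - 1)) : ℕ)) :
    ¬ p ∣ NumberField.classNumber K := by
  have h4 : 4 < (NumberField.discr K).natAbs := by
    have := four_mul_two_pow_lt_natAbs hn hd hsmall
    have h1 : 1 ≤ 2 ^ (n - 2 - 1) := Nat.one_le_two_pow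
    omega
  exact not_dvd_classNumber_of_dvd_of_sqrt_mul_log_lt hK h4
    (sub_two_dvd_classNumber_of_discr_eq_sq_sub_two_pow hK hn hd hx hsmall) hp hp2 hpn hlt

end Summit.BirchSwinnertonDyer.BirchSwinnertonDyer.Theorems.SplitPrimeOrder

end
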